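import Literature.Analysis.FluidPDE.HeatExtensionDistribution
import Literature.Analysis.FluidPDE.GKPCriticalElements
import Literature.Analysis.FluidPDE.LittlewoodPaleyBlockFn
import Literature.Analysis.FunctionSpaces.LittlewoodPaleyHeatProofs
import Literature.Analysis.FunctionSpaces.LittlewoodPaleyConvergenceProofs
import Literature.Analysis.UnboundedOperators.HeatKernelLpSmoothingProofs
import Literature.Analysis.UnboundedOperators.HeatKernelGaussianData
import Mathlib.MeasureTheory.Integral.MeanInequalities
import HarnessLib

/-!
# Kato smallness of the free evolution of critical Besov data

Analysis/FluidPDE proof file (no definitions, no named facts). It proves item (F2) of the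
decomposition of `exists_isBesovMildSolutionOn` (BCD Thm. 5.40; Gallagher–Koch–Planchon 2016,
§1.2 and App. B): the first step of the local Cauchy theory in `Ḃ^{-1+3/p}_{p,q}`, `q < ∞` —
the free evolution `e^{tΔ}u₀` of such a datum is *small* in Kato's weighted norms on short time
intervals:

* `tendsto_rpow_mul_eLpNormDistrib_heatSemigroup_nhdsGT_zero` (any dimension, distributions):
  for `σ > 0`, `1 ≤ q < ∞` and `U₀ ∈ Ḃ^{-σ}_{p,q}`, `t^{σ/2} ‖e^{tΔ}U₀‖_{L^p} → 0` as `t → 0⁺`.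
  Proof: `t^{σ/2}‖e^{tΔ}U₀‖_{L^p} ≤ C ∑_j φ(4^j t) w_j` with `w_j = 2^{-jσ}‖Δ̇_j U₀‖_{L^p} ∈ ℓ^q`,
  `φ(λ) = λ^{σ/2}e^{-κλ}` (the heat estimate on blocks, GKP App. B / BCD Lemma 2.4, as in the
  tree's `exists_eLpNormDistrib_heatSemigroup_le_rpow_mul_eHomBesovNorm`, which is the `O(1)`
  statement); writing `φ w = φ^{1/2} · (φ^{1/2} w)` and applying Hölder in `ℓ^{r'} × ℓ^r`,
  `r = max(q, 2)`, the first factor `(∑_j φ(4^jt)^{r'/2})^{1/r'}` is bounded uniformly in `t`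
  (`exists_tsum_rpow_mul_exp_neg_le`) and the second `(∑_j φ(4^jt)^{r/2} w_j^r)^{1/r}` tends to
  `0` by dominated convergence in `ℓ^1(ℤ)` (`φ ≤ M`, `∑ w_j^r < ∞`, `φ(4^jt) → 0` termwise);
* `besov_heatExtension_kato_small'` (`ℝ³`, functions): for `3 < p < ∞`, `1 ≤ q < ∞`, a field
  `u₀` with tempered distribution `U₀ ∈ Ḃ^{-1+3/p}_{p,q}` and `ε > 0` there is `T₀ > 0` with
  `‖e^{tΔ}u₀‖_{L^p} ≤ ε t^{-(1-3/p)/2}` and `|e^{tΔ}u₀(x)| ≤ ε t^{-1/2}` for `0 < t < T₀` and all `x`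
  (`e^{tΔ}u₀ = heatExtension u₀ t`, which represents `e^{tΔ}U₀` and is in `L^p` by
  `isDistributionOf_heatExtension_of_eLpNormDistrib_lt_top'`; the pointwise bound by the semigroup
  law `e^{tΔ} = e^{(t/2)Δ}e^{(t/2)Δ}` for Gaussian-integrable data and Hölder,
  `|e^{sΔ}g(x)| ≤ ‖G_s‖_{p'}‖g‖_p ≤ (4πs)^{-3/(2p)}‖g‖_p`, GKP Rem. 4.1).

## References

* I. Gallagher, G. Koch, F. Planchon, CMP 343 (2016) = arXiv:1407.4156, §1.2, Rem. 4.1,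
  App. B (Kato–Besov equivalence `‖e^{tΔ}v₀‖_{𝒦_p} ≈ ‖v₀‖_{Ḃ^{-1+3/p}_{p,∞}}`). [GKP2016]
* H. Bahouri, J.-Y. Chemin, R. Danchin (2011), Lemma 2.4, Thm. 2.34, Thm. 5.40.
  [BahouriCheminDanchin2011]
-/

noncomputable section

open MeasureTheory Set Function Filter
open _root_.Topology
open scoped SchwartzMap ENNReal NNReal Convolution

namespace Literature.Analysis.FluidPDE

/-! ## Smallness of `t^{σ/2}‖e^{tΔ}U₀‖_{L^p}` for `U₀ ∈ Ḃ^{-σ}_{p,q}`, `q < ∞` -/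

section Distributions

variable {E F : Type*} [NormedAddCommGroup E] [InnerProductSpace ℝ E] [FiniteDimensional ℝ E]
  [MeasurableSpace E] [BorelSpace E] [NormedAddCommGroup F] [NormedSpace ℂ F] [CompleteSpace F]

/-- `(xᵃ e^{-κx})ᵇ = x^{ab} e^{-κbx}` for `x ≥ 0`. [folklore] -/
theorem rpow_mul_exp_neg_rpow {x a κ b : ℝ} (hx : 0 ≤ x) :
    (x ^ a * Real.exp (-κ * x)) ^ b = x ^ (a * b) * Real.exp (-(κ * b) * x) := by
  rw [Real.mul_rpow (Real.rpow_nonneg hx _) (Real.exp_pos _).le, ← Real.rpow_mul hx,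
    ← Real.exp_mul]
  congr 1
  ring_nf

/-- **Smallness of the free evolution of `Ḃ^{-σ}_{p,q}` data in Kato's norm, `q < ∞`**
(Gallagher–Koch–Planchon 2016, App. B and §1.2; BCD Thm. 2.34 / Lemma 2.4): for `σ > 0`,
`1 ≤ p`, `1 ≤ q < ∞` and `U₀ ∈ Ḃ^{-σ}_{p,q}(E; F)`, `t^{σ/2} ‖e^{tΔ}U₀‖_{L^p} → 0` as `t → 0⁺`.
(For `q = ∞` only boundedness holds, `exists_eLpNormDistrib_heatSemigroup_le_rpow_mul_eHomBesovNorm`.)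
[cite: GKP2016, App. B] -/
theorem tendsto_rpow_mul_eLpNormDistrib_heatSemigroup_nhdsGT_zero {σ : ℝ} (hσ : 0 < σ)
    {p q : ℝ≥0∞} [Fact (1 ≤ p)] (hq₁ : 1 ≤ q) (hq : q < ∞) {U₀ : 𝓢'(E, F)}
    (hU₀ : FunctionSpaces.MemHomBesov (-σ) p q U₀) :
    Tendsto (fun t : ℝ => ENNReal.ofReal (t ^ (σ / 2)) *
        FunctionSpaces.eLpNormDistrib p (TemperedDistribution.heatSemigroup t U₀))
      (𝓝[>] 0) (𝓝 0) := by
  -- ### exponents: `r = max(q, 2) > 1` and its conjugate `r'`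
  have hq0 : q ≠ 0 := (zero_lt_one.trans_le hq₁).ne'
  set r₀ : ℝ≥0∞ := max q 2 with hr₀
  have hr₀top : r₀ ≠ ∞ := by
    rw [hr₀]; exact (max_lt hq ENNReal.ofNat_lt_top).ne
  have hr₀0 : r₀ ≠ 0 := (lt_of_lt_of_le (by norm_num) (le_max_right q 2)).ne'
  have hU₀' : FunctionSpaces.MemHomBesov (-σ) p r₀ U₀ :=
    hU₀.of_exponent_le_third hq0 (le_max_left _ _)
  set r : ℝ := r₀.toReal with hr
  have hr2 : 2 ≤ r := by
    have h := (ENNReal.toReal_le_toReal ENNReal.ofNat_ne_top hr₀top).2 (le_max_right q 2)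
    simpa [hr] using h
  have hr1 : 1 < r := by linarith
  have hrpos : 0 < r := by linarith
  have hrr' : r.HolderConjugate (Real.conjExponent r) := Real.HolderConjugate.conjExponent hr1
  set r' : ℝ := Real.conjExponent r with hr'
  have hr'pos : 0 < r' := hrr'.symm.pos
  -- ### the weights `w_j = 2^{-jσ} ‖Δ̇_j U₀‖_{L^p} ∈ ℓ^r`
  set w : ℤ → ℝ≥0∞ := FunctionSpaces.lpBlockWeight (-σ) p U₀ with hw
  have hw_sum : ∫⁻ j, w j ^ r ∂Measure.count = FunctionSpaces.eHomBesovNorm (-σ) p r₀ U₀ ^ r := by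
    rw [FunctionSpaces.eHomBesovNorm, eLpNorm_eq_lintegral_rpow_enorm_toReal hr₀0 hr₀top,
      ← ENNReal.rpow_mul, one_div, ← hr, inv_mul_cancel₀ hrpos.ne', ENNReal.rpow_one]
    simp only [enorm_eq_self, hw]
  have hw_fin : ∫⁻ j, w j ^ r ∂Measure.count ≠ ∞ := by
    rw [hw_sum]; exact ENNReal.rpow_ne_top_of_nonneg hrpos.le hU₀'.1.ne
  have hw_top : ∀ j, w j ≠ ∞ := fun j => by
    have h : w j ≤ eLpNorm w r₀ Measure.count := by
      simpa only [enorm_eq_self] using enorm_le_eLpNorm_count w j hr₀0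
    have hfin : eLpNorm w r₀ Measure.count < ∞ := hU₀'.1
    exact (h.trans_lt hfin).ne
  -- ### constants: heat flow on blocks, `sup φ`, the dyadic sums of `φ^{r'/2}`
  obtain ⟨C, -, hC⟩ := FunctionSpaces.exists_eLpNormDistrib_heatSemigroup_lpBlock_le (E := E) (F := F) p
  obtain ⟨M, hM0, hM⟩ := FunctionSpaces.exists_rpow_mul_exp_neg_mul_le (a := σ / 2) (κ := Real.pi ^ 2 / 8)
    (by positivity) (by positivity)
  obtain ⟨K, hKtop, hK⟩ := FunctionSpaces.exists_tsum_rpow_mul_exp_neg_le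
    (a := σ / 2 * (r' / 2)) (κ := Real.pi ^ 2 / 8 * (r' / 2)) (by positivity) (by positivity)
  -- `φ_j(t) = (4^j t)^{σ/2} e^{-κ 4^j t}` as an `ℝ≥0∞`-valued function
  set φ : ℤ → ℝ → ℝ≥0∞ := fun j t =>
    ENNReal.ofReal (((4 : ℝ) ^ j * t) ^ (σ / 2) * Real.exp (-(Real.pi ^ 2 / 8) * ((4 : ℝ) ^ j * t)))
    with hφ
  have hφM : ∀ j t, 0 ≤ t → φ j t ≤ ENNReal.ofReal M := fun j t ht =>
    ENNReal.ofReal_le_ofReal (hM _ (by positivity))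
  have hφ0 : ∀ j, Tendsto (φ j) (𝓝[>] 0) (𝓝 0) := by
    intro j
    have hc : Continuous fun t : ℝ => ((4 : ℝ) ^ j * t) ^ (σ / 2) *
        Real.exp (-(Real.pi ^ 2 / 8) * ((4 : ℝ) ^ j * t)) :=
      ((Real.continuous_rpow_const (by positivity)).comp (continuous_const.mul continuous_id)).mul
        (Real.continuous_exp.comp (continuous_const.mul (continuous_const.mul continuous_id)))
    have h := ((ENNReal.continuous_ofReal.comp hc).tendsto 0).mono_left
      (nhdsWithin_le_nhds (s := Ioi (0 : ℝ)))
    simp only [Function.comp_def, mul_zero, Real.zero_rpow (by positivity : σ / 2 ≠ 0), zero_mul,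
      ENNReal.ofReal_zero] at h
    simpa only [hφ] using h
  -- ### the pointwise-in-`t` estimate `t^{σ/2}‖e^{tΔ}U₀‖ ≤ C ∑_j φ_j(t) w_j`
  have hmain : ∀ t : ℝ, 0 < t → ENNReal.ofReal (t ^ (σ / 2)) *
      FunctionSpaces.eLpNormDistrib p (TemperedDistribution.heatSemigroup t U₀) ≤
        C * ∑' j : ℤ, φ j t * w j := by
    intro t ht
    have hreal := FunctionSpaces.tendsto_lowFreqCutoff_heatSemigroup_atBot hU₀.2 ht.le
    have hsum := FunctionSpaces.eLpNormDistrib_le_tsum_lpBlock (p := p)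
      (TemperedDistribution.heatSemigroup t U₀) hreal
    have hterm : ∀ j : ℤ, ENNReal.ofReal (t ^ (σ / 2)) *
        FunctionSpaces.eLpNormDistrib p (FunctionSpaces.lpBlock j (TemperedDistribution.heatSemigroup t U₀)) ≤
          C * (φ j t * w j) := by
      intro j
      rw [FunctionSpaces.lpBlock_heatSemigroup_comm ht.le]
      have hblock : FunctionSpaces.eLpNormDistrib p (FunctionSpaces.lpBlock j U₀) =
          (2 : ℝ≥0∞) ^ ((j : ℝ) * σ) * w j := by
        simp only [hw, FunctionSpaces.lpBlockWeight]
        rw [← mul_assoc, FunctionSpaces.two_rpow_mul_two_rpow,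
          show (j : ℝ) * σ + (j : ℝ) * (-σ) = 0 by ring, ENNReal.rpow_zero, one_mul]
      calc ENNReal.ofReal (t ^ (σ / 2)) *
            FunctionSpaces.eLpNormDistrib p (TemperedDistribution.heatSemigroup t (FunctionSpaces.lpBlock j U₀))
          ≤ ENNReal.ofReal (t ^ (σ / 2)) * (C * ENNReal.ofReal (Real.exp (-(Real.pi ^ 2 / 8) * 2 ^ (2 * j) * t)) *
              FunctionSpaces.eLpNormDistrib p (FunctionSpaces.lpBlock j U₀)) := by
            gcongr; exact hC t ht.le j U₀
        _ = C * (φ j t * w j) := by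
            rw [hblock, FunctionSpaces.two_rpow_int_mul_eq_ofReal_four_zpow_rpow,
              FunctionSpaces.two_zpow_two_mul_eq_four_zpow, hφ]
            simp only
            rw [Real.mul_rpow (zpow_nonneg (by norm_num) _) ht.le,
              show -(Real.pi ^ 2 / 8) * (4 : ℝ) ^ j * t = -(Real.pi ^ 2 / 8) * ((4 : ℝ) ^ j * t) by ring,
              ENNReal.ofReal_mul (by positivity), ENNReal.ofReal_mul (by positivity)]
            ring
    calc ENNReal.ofReal (t ^ (σ / 2)) * FunctionSpaces.eLpNormDistrib p (TemperedDistribution.heatSemigroup t U₀)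
        ≤ ENNReal.ofReal (t ^ (σ / 2)) *
            ∑' j : ℤ, FunctionSpaces.eLpNormDistrib p (FunctionSpaces.lpBlock j (TemperedDistribution.heatSemigroup t U₀)) := by
          gcongr
      _ = ∑' j : ℤ, ENNReal.ofReal (t ^ (σ / 2)) *
            FunctionSpaces.eLpNormDistrib p (FunctionSpaces.lpBlock j (TemperedDistribution.heatSemigroup t U₀)) := by
          rw [ENNReal.tsum_mul_left]
      _ ≤ ∑' j : ℤ, C * (φ j t * w j) := ENNReal.tsum_le_tsum hterm
      _ = C * ∑' j : ℤ, φ j t * w j := ENNReal.tsum_mul_left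
  -- ### Hölder: `∑ φ w ≤ (∑ φ^{r'/2})^{1/r'} (∑ φ^{r/2} w^r)^{1/r}`
  have hholder : ∀ t : ℝ, 0 < t → ∑' j : ℤ, φ j t * w j ≤
      K ^ (1 / r') * (∫⁻ j, φ j t ^ (r / 2) * w j ^ r ∂Measure.count) ^ (1 / r) := by
    intro t ht
    have h := ENNReal.lintegral_mul_le_Lp_mul_Lq (Measure.count : Measure ℤ) hrr'.symm
      (f := fun j => φ j t ^ (1 / 2 : ℝ)) (g := fun j => φ j t ^ (1 / 2 : ℝ) * w j)
      (Measurable.of_discrete.aemeasurable) (Measurable.of_discrete.aemeasurable)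
    have hfg : ∀ j, (fun j => φ j t ^ (1 / 2 : ℝ)) j * (fun j => φ j t ^ (1 / 2 : ℝ) * w j) j =
        φ j t * w j := by
      intro j
      show φ j t ^ (1 / 2 : ℝ) * (φ j t ^ (1 / 2 : ℝ) * w j) = φ j t * w j
      rw [← mul_assoc, ← ENNReal.rpow_add_of_nonneg _ _ (by norm_num) (by norm_num),
        show (1 / 2 : ℝ) + 1 / 2 = 1 by norm_num, ENNReal.rpow_one]
    have hf : ∀ j, (φ j t ^ (1 / 2 : ℝ)) ^ r' = ENNReal.ofReal ((((4 : ℝ) ^ j * t) ^ (σ / 2 * (r' / 2))) *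
        Real.exp (-(Real.pi ^ 2 / 8 * (r' / 2)) * ((4 : ℝ) ^ j * t))) := by
      intro j
      rw [← ENNReal.rpow_mul, hφ]
      simp only
      rw [ENNReal.ofReal_rpow_of_nonneg (by positivity) (by positivity),
        rpow_mul_exp_neg_rpow (by positivity)]
      congr 1
      congr 1
      · congr 1; ring
      · congr 1; ring
    have hg : ∀ j, (φ j t ^ (1 / 2 : ℝ) * w j) ^ r = φ j t ^ (r / 2) * w j ^ r := by
      intro j
      rw [ENNReal.mul_rpow_of_nonneg _ _ hrpos.le, ← ENNReal.rpow_mul]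
      congr 2; ring
    rw [lintegral_count] at h
    simp only [Pi.mul_apply] at h
    simp_rw [hfg] at h
    refine h.trans ?_
    have hA : (∫⁻ j, (φ j t ^ (1 / 2 : ℝ)) ^ r' ∂Measure.count) ^ (1 / r') ≤ K ^ (1 / r') := by
      gcongr
      rw [lintegral_count]
      simp_rw [hf]
      exact hK t ht
    have hB : (∫⁻ j, (φ j t ^ (1 / 2 : ℝ) * w j) ^ r ∂Measure.count) =
        ∫⁻ j, φ j t ^ (r / 2) * w j ^ r ∂Measure.count := lintegral_congr fun j => hg j
    rw [hB]
    exact mul_le_mul_left hA _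
  -- ### the second factor tends to `0` by dominated convergence
  have hdom : Tendsto (fun t : ℝ => ∫⁻ j, φ j t ^ (r / 2) * w j ^ r ∂Measure.count) (𝓝[>] 0)
      (𝓝 (∫⁻ _ : ℤ, (0 : ℝ≥0∞) ∂Measure.count)) := by
    refine tendsto_lintegral_filter_of_dominated_convergence
      (fun j => ENNReal.ofReal M ^ (r / 2) * w j ^ r) ?_ ?_ ?_ ?_
    · exact Eventually.of_forall fun t => Measurable.of_discrete
    · filter_upwards [self_mem_nhdsWithin] with t ht
      exact Eventually.of_forall fun j => by
        gcongr
        exact hφM j t (le_of_lt ht)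
    · rw [lintegral_const_mul' _ _ (ENNReal.rpow_ne_top_of_nonneg (by positivity) ENNReal.ofReal_ne_top)]
      exact ENNReal.mul_ne_top (ENNReal.rpow_ne_top_of_nonneg (by positivity) ENNReal.ofReal_ne_top) hw_fin
    · refine Eventually.of_forall fun j => ?_
      have h1 : Tendsto (fun t => φ j t ^ (r / 2)) (𝓝[>] 0) (𝓝 0) := by
        have h := ((ENNReal.continuous_rpow_const (y := r / 2)).tendsto 0).comp (hφ0 j)
        simpa only [Function.comp_def, ENNReal.zero_rpow_of_pos (by positivity : 0 < r / 2)] using h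
      have h2 := ENNReal.Tendsto.mul_const h1 (b := w j ^ r)
        (Or.inr (ENNReal.rpow_ne_top_of_nonneg hrpos.le (hw_top j)))
      simpa only [zero_mul] using h2
  rw [lintegral_zero] at hdom
  have hsecond : Tendsto (fun t : ℝ => (∫⁻ j, φ j t ^ (r / 2) * w j ^ r ∂Measure.count) ^ (1 / r))
      (𝓝[>] 0) (𝓝 0) := by
    have h := ((ENNReal.continuous_rpow_const (y := 1 / r)).tendsto 0).comp hdom
    simpa only [Function.comp_def, ENNReal.zero_rpow_of_pos (by positivity : 0 < 1 / r)] using h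
  have hprod : Tendsto (fun t : ℝ => (C : ℝ≥0∞) * (K ^ (1 / r') *
      (∫⁻ j, φ j t ^ (r / 2) * w j ^ r ∂Measure.count) ^ (1 / r))) (𝓝[>] 0) (𝓝 0) := by
    have h1 := ENNReal.Tendsto.const_mul hsecond (a := K ^ (1 / r'))
      (Or.inr (ENNReal.rpow_ne_top_of_nonneg (by positivity) hKtop))
    rw [mul_zero] at h1
    have h2 := ENNReal.Tendsto.const_mul h1 (a := (C : ℝ≥0∞)) (Or.inr ENNReal.coe_ne_top)
    rwa [mul_zero] at h2
  -- ### conclusion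
  refine tendsto_of_tendsto_of_tendsto_of_le_of_le' tendsto_const_nhds hprod
    (Eventually.of_forall fun _ => zero_le) ?_
  filter_upwards [self_mem_nhdsWithin] with t ht
  calc ENNReal.ofReal (t ^ (σ / 2)) * FunctionSpaces.eLpNormDistrib p (TemperedDistribution.heatSemigroup t U₀)
      ≤ C * ∑' j : ℤ, φ j t * w j := hmain t ht
    _ ≤ C * (K ^ (1 / r') * (∫⁻ j, φ j t ^ (r / 2) * w j ^ r ∂Measure.count) ^ (1 / r)) := by
        gcongr; exact hholder t ht

end Distributions

/-! ## The function-level statement on `ℝ³` -/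

section R3

/-- From the weighted bound `t^a X ≤ b` (`ℝ≥0∞`, `t > 0`) to `X ≤ b t^{-a}`. [folklore] -/
theorem le_ofReal_mul_rpow_neg_of_weighted_le' {X : ℝ≥0∞} {t a b : ℝ} (ht : 0 < t)
    (h : ENNReal.ofReal (t ^ a) * X ≤ ENNReal.ofReal b) :
    X ≤ ENNReal.ofReal (b * t ^ (-a)) := by
  have hta : 0 < t ^ a := Real.rpow_pos_of_pos ht _
  have h2 : X ≤ ENNReal.ofReal b / ENNReal.ofReal (t ^ a) := by
    rw [ENNReal.le_div_iff_mul_le (Or.inl (ENNReal.ofReal_pos.2 hta).ne')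
      (Or.inl ENNReal.ofReal_ne_top), mul_comm]
    exact h
  refine h2.trans (le_of_eq ?_)
  rw [← ENNReal.ofReal_div_of_pos hta, Real.rpow_neg ht.le, div_eq_mul_inv]

/-- **`L^{p'}` size of the heat kernel on `ℝ³`**: `‖G_s‖_{L^{p'}} ≤ (4π)^{-3/(2p)} s^{-3/(2p)}` for
`s > 0` and conjugate exponents `1/p + 1/p' = 1` (`eLpNorm_heatKernel_le` with `1 - 1/p' = 1/p`).
[folklore] -/
theorem eLpNorm_heatKernel_conj_le_R3 {p p' : ℝ≥0∞} [hpp' : p.HolderConjugate p'] {s : ℝ}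
    (hs : 0 < s) :
    eLpNorm (UnboundedOperators.heatKernel (E := EuclideanSpace ℝ (Fin 3)) s) p' volume ≤
      ENNReal.ofReal ((4 * Real.pi) ^ (-(3 * p.toReal⁻¹ / 2)) * s ^ (-(3 * p.toReal⁻¹ / 2))) := by
  haveI : p'.HolderConjugate p := inferInstance
  have h := UnboundedOperators.eLpNorm_heatKernel_le (E := EuclideanSpace ℝ (Fin 3)) hs
    (ENNReal.HolderConjugate.one_le p' p)
  rw [ENNReal.HolderConjugate.one_sub_inv p' p, ENNReal.toReal_inv, finrank_euclideanSpace_fin,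
    ENNReal.ofReal_rpow_of_nonneg (by positivity) (by positivity),
    ← Real.rpow_mul (by positivity)] at h
  refine h.trans (le_of_eq ?_)
  congr 1
  rw [Real.mul_rpow (by positivity) hs.le]
  congr 1 <;> (congr 1; push_cast; ring)

/-- **(F2) Kato smallness of the free evolution of critical Besov data on `ℝ³`**
(Gallagher–Koch–Planchon 2016, App. B and Rem. 4.1; §1.2, the first step of the local Cauchy
theory in `Ḃ^{s_p}_{p,q}`, `q < ∞`): for `3 < p < ∞`, `1 ≤ q < ∞`, a field `u₀` with tempered
distribution `U₀ ∈ Ḃ^{-1+3/p}_{p,q}(ℝ³)` and `ε > 0`, there is `T₀ > 0` such that for `0 < t < T₀`: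
`‖e^{tΔ}u₀‖_{L^p} ≤ ε t^{-(1-3/p)/2}` and `|e^{tΔ}u₀(x)| ≤ ε t^{-1/2}` for every `x`, where
`e^{tΔ}u₀ = heatExtension u₀ t` (it represents `e^{tΔ}U₀` and is in `L^p`,
`isDistributionOf_heatExtension_of_eLpNormDistrib_lt_top'`; the `L^p` part is
`tendsto_rpow_mul_eLpNormDistrib_heatSemigroup_nhdsGT_zero`; the pointwise part follows from it by
the semigroup law `e^{tΔ} = e^{(t/2)Δ}e^{(t/2)Δ}` and Hölder with `‖G_{t/2}‖_{L^{p'}} ≲ t^{-3/(2p)}`).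
This is the statement of the named fact `besov_heatExtension_kato_small` of the decomposition of
`exists_isBesovMildSolutionOn`. [cite: GKP2016, App. B and Rem. 4.1] -/
theorem besov_heatExtension_kato_small' {p q : ℝ≥0∞} [hp1 : Fact (1 ≤ p)] (hp₃ : 3 < p)
    (hp : p < ∞) (hq₁ : 1 ≤ q) (hq : q < ∞) {u₀ : EuclideanSpace ℝ (Fin 3) → EuclideanSpace ℝ (Fin 3)}
    {U₀ : 𝓢'(EuclideanSpace ℝ (Fin 3), EuclideanSpace ℂ (Fin 3))}
    (hU₀ : IsDistributionOf u₀ U₀)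
    (hB : FunctionSpaces.MemHomBesov (-1 + 3 / p.toReal) p q U₀) {ε : ℝ} (hε : 0 < ε) :
    ∃ T₀ : ℝ, 0 < T₀ ∧ ∀ t ∈ Ioo 0 T₀,
      eLpNorm (UnboundedOperators.heatExtension u₀ t) p volume ≤
          ENNReal.ofReal (ε * t ^ (-((1 - 3 / p.toReal) / 2))) ∧
        ∀ x, ‖UnboundedOperators.heatExtension u₀ t x‖ ≤ ε * t ^ (-(1 / 2 : ℝ)) := by
  -- ### exponents
  have hp3r : (3 : ℝ) < p.toReal := by
    have h := ENNReal.toReal_strict_mono hp.ne hp₃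
    simpa using h
  have hppos : 0 < p.toReal := by linarith
  set α : ℝ := p.toReal⁻¹ with hα
  set σ : ℝ := 1 - 3 / p.toReal with hσdef
  have hσα : σ = 1 - 3 * α := by rw [hσdef, hα, div_eq_mul_inv]
  have hσ : 0 < σ := by
    have : 3 / p.toReal < 1 := (div_lt_one hppos).2 hp3r
    rw [hσdef]; linarith
  have hidx : -σ = -1 + 3 / p.toReal := by rw [hσdef]; ring
  have hB' : FunctionSpaces.MemHomBesov (-σ) p q U₀ := by rw [hidx]; exact hB
  -- conjugate exponent for Hölder
  haveI hpp' : p.HolderConjugate (ENNReal.conjExponent p) := .conjExponent hp1.out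
  haveI : (ENNReal.conjExponent p).HolderConjugate p := inferInstance
  -- ### data facts
  have hmeas : AEStronglyMeasurable u₀ volume := hU₀.aestronglyMeasurable
  have hG : ∀ a : ℝ, 0 < a → Integrable (fun y => UnboundedOperators.heatKernel a y * ‖u₀ y‖) volume :=
    fun a ha => by
      have h := (hU₀ (FunctionSpaces.heatKernelSchwartz (EuclideanSpace ℝ (Fin 3)) a)).1.norm
      refine h.congr (Eventually.of_forall fun y => ?_)
      simp only [norm_smul, FunctionSpaces.heatKernelSchwartz_apply ha, Complex.norm_real,
        Real.norm_eq_abs, FunctionSpaces.EuclideanSpace.norm_complexify,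
        abs_of_pos (UnboundedOperators.heatKernel_pos ha y)]
  -- ### the constant of the pointwise bound and the choice of `ε'`
  set A : ℝ := (4 * Real.pi) ^ (-(3 * α / 2)) with hA
  have hApos : 0 < A := Real.rpow_pos_of_pos (by positivity) _
  set c : ℝ := A * (2 : ℝ) ^ (1 / 2 : ℝ) with hc
  have hcpos : 0 < c := by positivity
  set ε' : ℝ := ε / (1 + c) with hε'
  have hε'pos : 0 < ε' := by positivity
  have hε'le : ε' ≤ ε := by
    rw [hε', div_le_iff₀ (by positivity)]; nlinarith
  have hcε' : c * ε' ≤ ε := by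
    rw [hε', mul_div_assoc', div_le_iff₀ (by positivity)]; nlinarith
  -- ### the window from the distribution-level smallness
  have hA0 := tendsto_rpow_mul_eLpNormDistrib_heatSemigroup_nhdsGT_zero hσ hq₁ hq hB'
  have hev : ∀ᶠ t in 𝓝[>] (0 : ℝ), ENNReal.ofReal (t ^ (σ / 2)) *
      FunctionSpaces.eLpNormDistrib p (TemperedDistribution.heatSemigroup t U₀) ≤ ENNReal.ofReal ε' :=
    (ENNReal.tendsto_nhds_zero.1 hA0) _ (ENNReal.ofReal_pos.2 hε'pos)
  rw [Filter.Eventually, mem_nhdsGT_iff_exists_Ioo_subset] at hev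
  obtain ⟨T₀, hT₀, hT⟩ := hev
  have hT₀pos : 0 < T₀ := hT₀
  -- the `L^p` statement on the window
  have hLp : ∀ t ∈ Ioo 0 T₀,
      IsDistributionOf (UnboundedOperators.heatExtension u₀ t) (TemperedDistribution.heatSemigroup t U₀) ∧
        MemLp (UnboundedOperators.heatExtension u₀ t) p volume ∧
        eLpNorm (UnboundedOperators.heatExtension u₀ t) p volume ≤ ENNReal.ofReal (ε' * t ^ (-(σ / 2))) := by
    intro t ht
    have hw : ENNReal.ofReal (t ^ (σ / 2)) *
        FunctionSpaces.eLpNormDistrib p (TemperedDistribution.heatSemigroup t U₀) ≤ ENNReal.ofReal ε' := hT ht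
    have hfin : FunctionSpaces.eLpNormDistrib p (TemperedDistribution.heatSemigroup t U₀) < ∞ := by
      have h := le_ofReal_mul_rpow_neg_of_weighted_le' ht.1 hw
      exact h.trans_lt ENNReal.ofReal_lt_top
    obtain ⟨hD, hM⟩ := isDistributionOf_heatExtension_of_eLpNormDistrib_lt_top' hU₀ ht.1 hfin
    refine ⟨hD, hM, ?_⟩
    rw [← hD.eLpNormDistrib_eq hM]
    exact le_ofReal_mul_rpow_neg_of_weighted_le' ht.1 hw
  refine ⟨T₀, hT₀pos, fun t ht => ⟨?_, fun x => ?_⟩⟩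
  · -- `L^p` bound with `ε`
    refine ((hLp t ht).2.2).trans (ENNReal.ofReal_le_ofReal ?_)
    have : 0 ≤ t ^ (-(σ / 2)) := Real.rpow_nonneg ht.1.le _
    rw [show -((1 - 3 / p.toReal) / 2) = -(σ / 2) by rw [hσdef]]
    nlinarith
  · -- pointwise bound through `e^{tΔ} = e^{(t/2)Δ} e^{(t/2)Δ}` and Hölder
    have htpos : 0 < t := ht.1
    have ht2 : t / 2 ∈ Ioo 0 T₀ := ⟨by linarith [ht.1], by linarith [ht.2]⟩
    have ht2pos : 0 < t / 2 := ht2.1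
    obtain ⟨-, hgLp, hgbound⟩ := hLp (t / 2) ht2
    set g : EuclideanSpace ℝ (Fin 3) → EuclideanSpace ℝ (Fin 3) :=
      UnboundedOperators.heatExtension u₀ (t / 2) with hgdef
    have hsemi : UnboundedOperators.heatExtension u₀ t x = UnboundedOperators.heatExtension g (t / 2) x := by
      rw [hgdef, UnboundedOperators.heatExtension_heatExtension_apply_of_integrable_heatKernel_mul_norm
        hmeas hG ht2pos ht2pos x, add_halves]
    have hK : AEStronglyMeasurable (UnboundedOperators.heatKernel (E := EuclideanSpace ℝ (Fin 3)) (t / 2)) volume :=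
      (UnboundedOperators.continuous_heatKernel _).aestronglyMeasurable
    have h1 := UnboundedOperators.enorm_convolution_lsmul_le_eLpNorm_mul_eLpNorm hK hgLp.1
      (ENNReal.conjExponent p) p x
    have h2 := eLpNorm_heatKernel_conj_le_R3 (p := p) (p' := ENNReal.conjExponent p) ht2pos
    have h3 : ‖UnboundedOperators.heatExtension g (t / 2) x‖ₑ ≤
        ENNReal.ofReal (A * (t / 2) ^ (-(3 * α / 2))) * ENNReal.ofReal (ε' * (t / 2) ^ (-(σ / 2))) := by
      rw [UnboundedOperators.heatExtension]
      refine h1.trans (mul_le_mul' ?_ hgbound)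
      simpa only [hA, hα] using h2
    -- the exponent arithmetic `(t/2)^{-3α/2} (t/2)^{-σ/2} = 2^{1/2} t^{-1/2}`
    have hexp : A * (t / 2) ^ (-(3 * α / 2)) * (ε' * (t / 2) ^ (-(σ / 2))) = c * ε' * t ^ (-(1 / 2 : ℝ)) := by
      have hsum : (t / 2) ^ (-(3 * α / 2)) * (t / 2) ^ (-(σ / 2)) = (t / 2) ^ (-(1 / 2 : ℝ)) := by
        rw [← Real.rpow_add ht2pos]
        congr 1
        rw [hσα]; ring
      have hhalf : (t / 2) ^ (-(1 / 2 : ℝ)) = (2 : ℝ) ^ (1 / 2 : ℝ) * t ^ (-(1 / 2 : ℝ)) := by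
        rw [Real.div_rpow ht.1.le zero_le_two, Real.rpow_neg zero_le_two, div_inv_eq_mul, mul_comm]
      calc A * (t / 2) ^ (-(3 * α / 2)) * (ε' * (t / 2) ^ (-(σ / 2)))
          = A * ε' * ((t / 2) ^ (-(3 * α / 2)) * (t / 2) ^ (-(σ / 2))) := by ring
        _ = c * ε' * t ^ (-(1 / 2 : ℝ)) := by rw [hsum, hhalf, hc]; ring
    have h4 : ‖UnboundedOperators.heatExtension u₀ t x‖ₑ ≤ ENNReal.ofReal (c * ε' * t ^ (-(1 / 2 : ℝ))) := by
      rw [hsemi]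
      refine h3.trans (le_of_eq ?_)
      rw [← ENNReal.ofReal_mul (by positivity), hexp]
    have h5 : ‖UnboundedOperators.heatExtension u₀ t x‖ ≤ c * ε' * t ^ (-(1 / 2 : ℝ)) := by
      rw [← ofReal_norm] at h4
      exact (ENNReal.ofReal_le_ofReal_iff (by positivity)).1 h4
    refine h5.trans ?_
    have : 0 ≤ t ^ (-(1 / 2 : ℝ)) := Real.rpow_nonneg ht.1.le _
    nlinarith

end R3

end Literature.Analysis.FluidPDE
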